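import Summits.AtomisticToContinuum.HydrodynamicLimit.Theorems.CollisionIsometryCLTAdaptedWeightCLTLine
import Literature.Analysis.FluidPDE.HardSphereFlowMeasurable
import Literature.Analysis.FluidPDE.HardSphereRegularGeometry

/-!
# `stub_reduction` of the line `contact-source-duhamel`, helper file 3/6: measurability of the fold data
(crux `CollisionIsometryCLT.AdaptedWeightCLT`, stmt-AtomisticToContinuum-14868 = rev-12 TIME-LOCAL crux; `--supports`)

The integrability bookkeeping of `stub_reduction` needs the fold functionals of the line (`pastF`, `xiF`,
`xiChF`, objects of `…AdaptedWeightCLTLine`) to be MEASURABLE in the window-start configuration `y`, the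
weights and the shift. This file handles the discrete data of a fold step and the velocity fold:
* composition-form measurability of the tensor maps `tpow`, `mapT`, `pairT`, `projM`, `coprojM`, `projV`,
  `coprojV`, `crossT` (polynomial / rational maps, `0/0 = 0` via `Measurable.div`);
* `pre σ N y k` is measurable in `y` (`Alexander.measurable_stateAfter`, `measurable_freeExitTime`,
  `measurable_freeFlight₂` of `HardSphereFlowMeasurable`; regular and measurable torus geometry at diameter
  `hsDiameter σ N ≤ σ < 1/2`);
* `stepPair σ N y k = pairOf (incomingPairs (pre σ N y k))` only depends on the SET of incoming pairs, which
  takes finitely many values on measurable level sets (`Alexander.measurableSet_mem_incomingPairs`), so every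
  level set `{y | stepPair σ N y k = o}` is measurable (`measurableSet_stepPair_eq`), and a function defined
  by cases on it is measurable as soon as each case is (`measurable_of_countable_cases`);
* case by case: `stepNormal`, `stepMap` (hence `transferSteps`, `velAfter`) are measurable;
* the fold step preserves `Σ_i ‖W_i‖²` (one elastic reflection, `configEnergy_collidePair`), whence the
  velocity bound `‖velAfter σ N y m i‖ ≤ √(Σ_j ‖(y j).2‖²)` used for the sup bounds along the flow.
Registered anchor: `reduction_measurable_pre`.
-/

namespace Summit.AtomisticToContinuum.HydrodynamicLimit.Theorems.ContactSourceDuhamel.TimeLocal.Reduction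

open scoped BigOperators Topology Classical MeasureTheory ENNReal InnerProductSpace
open Filter Set MeasureTheory
open Literature.Analysis.FluidPDE
open Literature.MathematicalPhysics.KineticTheory (hsDiameter hsDiameter_le)

noncomputable section

variable {σ : ℝ} {N : ℕ} {r : ℕ}

/-! ## Generalities -/

/-- The torus geometry is measurable (`Torus.isMeasurable_geometry`). -/
theorem gm : (Torus.geometry (Fin 3)).IsMeasurable := Torus.isMeasurable_geometry

/-- A function defined by countably many measurable cases, selected by a map with measurable level sets,
is measurable. -/
theorem measurable_of_countable_cases {α β ι : Type*} [MeasurableSpace α] [MeasurableSpace β]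
    [Countable ι] {o : α → ι} (ho : ∀ i, MeasurableSet {a | o a = i}) {F : ι → α → β}
    (hF : ∀ i, Measurable (F i)) : Measurable fun a => F (o a) a := by
  letI : MeasurableSpace ι := ⊤
  haveI : MeasurableSingletonClass ι := ⟨fun _ => trivial⟩
  have ho' : Measurable o := measurable_to_countable' fun i => ho i
  exact (measurable_from_prod_countable_right (f := fun p : ι × α => F p.1 p.2) hF).comp
    (ho'.prodMk measurable_id)

/-- A coordinate of a velocity is a measurable function of the velocity. -/
theorem measurable_coord (a : Fin 3) : Measurable fun n : V3 => n a := by fun_prop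

/-- Updating one entry of a measurable family by a measurable value is measurable (coordinatewise;
the `DecidableEq` instance is the one of the goal). -/
theorem measurable_update_of {α ι X : Type*} [MeasurableSpace α] [MeasurableSpace X]
    {_ : DecidableEq ι} {f : α → ι → X} {i : ι} {g : α → X} (hf : Measurable f) (hg : Measurable g) :
    Measurable fun a => Function.update (f a) i (g a) := by
  refine measurable_pi_iff.2 fun l => ?_
  by_cases h : l = i
  · subst h
    simp only [Function.update_self]
    exact hg
  · simp only [Function.update_of_ne h]
    exact (measurable_pi_iff.1 hf) l

/-! ## Tensor maps (composition form: `Measurable fun a => F (f a) …`) -/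

section Comp

variable {α : Type*} [MeasurableSpace α]

/-- `a ↦ (f a)^{⊗r}` is measurable for measurable `f`. -/
theorem measurable_tpow {f : α → V3} (hf : Measurable f) : Measurable fun a => tpow r (f a) :=
  measurable_pi_lambda _ fun idx => Finset.measurable_prod _ fun s _ => (measurable_coord (idx s)).comp hf

/-- `a ↦ (P a)^{⊗r} (T a)` is measurable for measurable `P`, `T`. -/
theorem measurable_mapT {P : α → Mat3} {T : α → Tens r} (hP : Measurable P) (hT : Measurable T) :
    Measurable fun a => mapT (P a) (T a) := by
  refine measurable_pi_lambda _ fun idx => Finset.measurable_sum _ fun idx' _ => ?_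
  refine (Finset.measurable_prod _ fun s _ => ?_).mul ((measurable_pi_apply idx').comp hT)
  exact (measurable_pi_apply (idx' s)).comp ((measurable_pi_apply (idx s)).comp hP)

/-- `a ↦ ⟨C, T a⟩` is measurable for measurable `T`. -/
theorem measurable_pairT (C : Tens r) {T : α → Tens r} (hT : Measurable T) :
    Measurable fun a => pairT C (T a) :=
  Finset.measurable_sum _ fun idx _ => ((measurable_pi_apply idx).comp hT).const_mul _

/-- `a ↦ P(n a)` (matrix of the normal projection) is measurable for measurable `n`. -/
theorem measurable_projM {n : α → V3} (hn : Measurable n) : Measurable fun a => projM (n a) :=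
  measurable_pi_lambda _ fun a => measurable_pi_lambda _ fun b =>
    (((measurable_coord a).comp hn).mul ((measurable_coord b).comp hn)).div (hn.norm.pow_const 2)

/-- `a ↦ Q(n a)` (matrix of the tangential projection) is measurable for measurable `n`. -/
theorem measurable_coprojM {n : α → V3} (hn : Measurable n) : Measurable fun a => coprojM (n a) :=
  measurable_pi_lambda _ fun a => measurable_pi_lambda _ fun b =>
    measurable_const.sub ((((measurable_coord a).comp hn).mul ((measurable_coord b).comp hn)).div
      (hn.norm.pow_const 2))

/-- `a ↦ P_{n a} (y a)` is measurable for measurable `n`, `y`. -/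
theorem measurable_projV {n y : α → V3} (hn : Measurable n) (hy : Measurable y) :
    Measurable fun a => projV (n a) (y a) :=
  ((hn.inner hy).div (hn.norm.pow_const 2)).smul hn

/-- `a ↦ Q_{n a} (y a)` is measurable for measurable `n`, `y`. -/
theorem measurable_coprojV {n y : α → V3} (hn : Measurable n) (hy : Measurable y) :
    Measurable fun a => coprojV (n a) (y a) :=
  hy.sub (measurable_projV hn hy)

/-- `a ↦ crossT r (f a) (g a)` is measurable for measurable `f`, `g`. -/
theorem measurable_crossT {f g : α → V3} (hf : Measurable f) (hg : Measurable g) :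
    Measurable fun a => crossT r (f a) (g a) := by
  refine measurable_pi_lambda _ fun idx => Finset.measurable_sum _ fun S _ =>
    Finset.measurable_prod _ fun s _ => ?_
  by_cases hs : s ∈ S
  · simp only [hs, if_true]
    exact (measurable_coord (idx s)).comp hg
  · simp only [hs, if_false]
    exact (measurable_coord (idx s)).comp hf

end Comp

/-! ## The discrete data of a fold step -/

/-- `y ↦ pre σ N y k` is measurable (registered anchor of this helper file). -/
theorem reduction_measurable_pre : ∀ (σ : ℝ) (N k : ℕ),
    (Literature.Analysis.FluidPDE.Torus.geometry (Fin 3)).IsHardSphereRegular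
      (Literature.MathematicalPhysics.KineticTheory.hsDiameter σ N) →
        Measurable fun y : Cfg N => pre σ N y k := by
  intro σ N k hG
  have hst := Alexander.measurable_stateAfter (N := N + 1) hG gm k
  unfold pre
  exact (gm.measurable_freeFlight₂.comp
    ((((Alexander.measurable_freeExitTime hG gm).comp hst).ennreal_toReal).prodMk hst) :)

/-- `y ↦ pre σ N y k` is measurable. -/
theorem measurable_pre (hG : (Torus.geometry (Fin 3)).IsHardSphereRegular (hsDiameter σ N)) (k : ℕ) :
    Measurable fun y : Cfg N => pre σ N y k :=
  reduction_measurable_pre σ N k hG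

/-- The choice made by a fold step as a function of the SET of incoming pairs. -/
def pairOf (S : Set (Fin (N + 1) × Fin (N + 1))) : Option (Fin (N + 1) × Fin (N + 1)) :=
  @dite _ S.Nonempty (Classical.propDecidable _) (fun h => some h.some) (fun _ => none)

/-- `stepPair` through `pairOf`. -/
theorem stepPair_eq_pairOf (y : Cfg N) (k : ℕ) :
    stepPair σ N y k = pairOf (Alexander.incomingPairs (Torus.geometry (Fin 3)) (hsDiameter σ N)
      (pre σ N y k)) := rfl

/-- A reflected pair is an ordered pair `i < j`. -/
theorem stepPair_fst_lt_snd {y : Cfg N} {k : ℕ} {ij : Fin (N + 1) × Fin (N + 1)}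
    (h : stepPair σ N y k = some ij) : ij.1 < ij.2 := by
  unfold stepPair at h
  by_cases hne : (Alexander.incomingPairs (Torus.geometry (Fin 3)) (hsDiameter σ N)
      (pre σ N y k)).Nonempty
  · rw [dif_pos hne, Option.some.injEq] at h
    rw [← h]
    exact (Alexander.mem_incomingPairs.1 hne.some_mem).1
  · rw [dif_neg hne] at h
    exact absurd h (by simp)

/-- The level sets of the set of incoming pairs of `pre σ N y k` are measurable. -/
theorem measurableSet_incomingPairs_pre_eq
    (hG : (Torus.geometry (Fin 3)).IsHardSphereRegular (hsDiameter σ N)) (k : ℕ)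
    (S : Set (Fin (N + 1) × Fin (N + 1))) :
    MeasurableSet {y : Cfg N | Alexander.incomingPairs (Torus.geometry (Fin 3)) (hsDiameter σ N)
      (pre σ N y k) = S} := by
  have hset : {y : Cfg N | Alexander.incomingPairs (Torus.geometry (Fin 3)) (hsDiameter σ N)
      (pre σ N y k) = S} = ⋂ p : Fin (N + 1) × Fin (N + 1),
        {y | p ∈ Alexander.incomingPairs (Torus.geometry (Fin 3)) (hsDiameter σ N) (pre σ N y k) ↔
          p ∈ S} := by
    ext y
    simp only [mem_setOf_eq, mem_iInter, Set.ext_iff]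
  rw [hset]
  refine MeasurableSet.iInter fun p => measurableSet_setOf.2 ?_
  have hp : MeasurableSet {w : Cfg N | p ∈ Alexander.incomingPairs (Torus.geometry (Fin 3))
      (hsDiameter σ N) w} := Alexander.measurableSet_mem_incomingPairs gm p
  exact (measurableSet_setOf.1 (hp.preimage (measurable_pre hG k))).iff measurable_const

/-- **The level sets of the reflected pair are measurable.** -/
theorem measurableSet_stepPair_eq (hG : (Torus.geometry (Fin 3)).IsHardSphereRegular (hsDiameter σ N))
    (k : ℕ) (o : Option (Fin (N + 1) × Fin (N + 1))) :
    MeasurableSet {y : Cfg N | stepPair σ N y k = o} := by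
  letI : MeasurableSpace (Set (Fin (N + 1) × Fin (N + 1))) := ⊤
  have hS : Measurable fun y : Cfg N => Alexander.incomingPairs (Torus.geometry (Fin 3))
      (hsDiameter σ N) (pre σ N y k) :=
    measurable_to_countable' fun S => measurableSet_incomingPairs_pre_eq hG k S
  exact hS (MeasurableSpace.measurableSet_top : MeasurableSet (pairOf ⁻¹' {o}))

/-- The collision normal as a function of the discrete data and the pre-collisional configuration. -/
def normalOf (o : Option (Fin (N + 1) × Fin (N + 1))) (z : Cfg N) : V3 :=
  match o with
  | none => 0
  | some ij => (Torus.geometry (Fin 3)).sepVec (z ij.1).1 (z ij.2).1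

/-- `stepNormal` through `normalOf`. -/
theorem stepNormal_eq (y : Cfg N) (k : ℕ) :
    stepNormal σ N y k = normalOf (stepPair σ N y k) (pre σ N y k) := by
  unfold stepNormal normalOf
  cases stepPair σ N y k <;> rfl

/-- `y ↦ stepNormal σ N y k` is measurable. -/
theorem measurable_stepNormal (hG : (Torus.geometry (Fin 3)).IsHardSphereRegular (hsDiameter σ N))
    (k : ℕ) : Measurable fun y : Cfg N => stepNormal σ N y k := by
  simp only [stepNormal_eq]
  refine measurable_of_countable_cases (measurableSet_stepPair_eq hG k)
    (F := fun o y => normalOf o (pre σ N y k)) fun o => ?_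
  cases o with
  | none => exact measurable_const
  | some ij => exact ((gm.measurable_sepVec_config ij.1 ij.2).comp (measurable_pre hG k) :)

/-! ## The velocity fold: `stepMap`, `transferSteps`, `velAfter` -/

/-- The velocity map of one fold step as a function of the discrete data and the pre-collisional
configuration. -/
def velMapOf (o : Option (Fin (N + 1) × Fin (N + 1))) (z : Cfg N) (W : Vel N) : Vel N :=
  match o with
  | none => W
  | some ij => fun i => (collidePair (Torus.geometry (Fin 3)) ij.1 ij.2 (fun j => ((z j).1, W j)) i).2

/-- `stepMap` through `velMapOf`. -/
theorem stepMap_eq (y : Cfg N) (k : ℕ) (W : Vel N) :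
    stepMap σ N y k W = velMapOf (stepPair σ N y k) (pre σ N y k) W := by
  unfold stepMap stepPair
  by_cases hne : (Alexander.incomingPairs (Torus.geometry (Fin 3)) (hsDiameter σ N)
      (pre σ N y k)).Nonempty
  · rw [dif_pos hne, dif_pos hne]
    rfl
  · rw [dif_neg hne, dif_neg hne]
    rfl

/-- `(z, W) ↦ velMapOf o z W` is measurable. -/
theorem measurable_velMapOf (o : Option (Fin (N + 1) × Fin (N + 1))) :
    Measurable fun p : Cfg N × Vel N => velMapOf o p.1 p.2 := by
  cases o with
  | none => exact measurable_snd
  | some ij =>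
    have hcfg : Measurable fun p : Cfg N × Vel N => (fun j => ((p.1 j).1, p.2 j) : Cfg N) :=
      measurable_pi_lambda (fun p : Cfg N × Vel N => (fun j => ((p.1 j).1, p.2 j) : Cfg N)) fun j =>
        ((Geometry.IsMeasurable.measurable_pos j).comp measurable_fst).prodMk
          ((measurable_pi_apply j).comp measurable_snd)
    have hcol := (gm.measurable_collidePair (N := N + 1) ij.1 ij.2).comp hcfg
    exact measurable_pi_lambda (fun p : Cfg N × Vel N => fun i =>
      (collidePair (Torus.geometry (Fin 3)) ij.1 ij.2 (fun j => ((p.1 j).1, p.2 j)) i).2) fun i =>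
        (Geometry.IsMeasurable.measurable_vel i).comp hcol

/-- `(y, W) ↦ stepMap σ N y k W` is measurable. -/
theorem measurable_stepMap (hG : (Torus.geometry (Fin 3)).IsHardSphereRegular (hsDiameter σ N))
    (k : ℕ) : Measurable fun p : Cfg N × Vel N => stepMap σ N p.1 k p.2 := by
  simp only [stepMap_eq]
  exact measurable_of_countable_cases (o := fun p : Cfg N × Vel N => stepPair σ N p.1 k)
    (fun o => measurable_fst (measurableSet_stepPair_eq hG k o))
    (F := fun o p => velMapOf o (pre σ N p.1 k) p.2)
    fun o => ((measurable_velMapOf o).comp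
      (((measurable_pre hG k).comp measurable_fst).prodMk measurable_snd) :)

/-- `(y, W) ↦ transferSteps σ N y m W` is measurable. -/
theorem measurable_transferSteps (hG : (Torus.geometry (Fin 3)).IsHardSphereRegular (hsDiameter σ N))
    (m : ℕ) : Measurable fun p : Cfg N × Vel N => transferSteps σ N p.1 m p.2 := by
  induction m with
  | zero => exact measurable_snd
  | succ m ih =>
    simp only [transferSteps_succ]
    exact ((measurable_stepMap hG m).comp (measurable_fst.prodMk ih) :)

/-- `y ↦ velAfter σ N y m` is measurable. -/
theorem measurable_velAfter (hG : (Torus.geometry (Fin 3)).IsHardSphereRegular (hsDiameter σ N))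
    (m : ℕ) : Measurable fun y : Cfg N => velAfter σ N y m := by
  have hv : Measurable fun y : Cfg N => (fun i => (y i).2 : Vel N) :=
    measurable_pi_lambda (fun y : Cfg N => (fun i => (y i).2 : Vel N)) fun i =>
      Geometry.IsMeasurable.measurable_vel i
  have h := (measurable_transferSteps hG m).comp (measurable_id.prodMk hv)
  exact h

/-- One fold step preserves `Σ_i ‖W_i‖²` (an elastic reflection of one pair, or the identity). -/
theorem sum_sq_stepMap (y : Cfg N) (k : ℕ) (W : Vel N) :
    ∑ i, ‖stepMap σ N y k W i‖ ^ 2 = ∑ i, ‖W i‖ ^ 2 := by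
  rw [stepMap_eq]
  rcases h : stepPair σ N y k with _ | ij
  · rfl
  · have hij : ij.1 ≠ ij.2 := (stepPair_fst_lt_snd h).ne
    have hE := configEnergy_collidePair (G := Torus.geometry (Fin 3)) hij
      (fun j => ((pre σ N y k j).1, W j))
    unfold configEnergy at hE
    simpa [velMapOf] using hE

/-- The fold velocities keep `Σ_i ‖v_i‖²`. -/
theorem sum_sq_velAfter (y : Cfg N) (m : ℕ) :
    ∑ i, ‖velAfter σ N y m i‖ ^ 2 = ∑ i, ‖(y i).2‖ ^ 2 := by
  induction m with
  | zero => rfl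
  | succ m ih =>
    have hsucc : velAfter σ N y (m + 1) = stepMap σ N y m (velAfter σ N y m) :=
      transferSteps_succ σ N y m _
    rw [hsucc, sum_sq_stepMap, ih]

/-- **Velocity bound along the fold**: `‖velAfter σ N y m i‖ ≤ √(Σ_j ‖(y j).2‖²)`. -/
theorem norm_velAfter_le_sqrt (y : Cfg N) (m : ℕ) (i : Fin (N + 1)) :
    ‖velAfter σ N y m i‖ ≤ Real.sqrt (∑ j, ‖(y j).2‖ ^ 2) := by
  rw [← sum_sq_velAfter y m]
  refine Real.le_sqrt_of_sq_le ?_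
  exact Finset.single_le_sum (f := fun j => ‖velAfter σ N y m j‖ ^ 2) (fun j _ => sq_nonneg _)
    (Finset.mem_univ i)

end

end Summit.AtomisticToContinuum.HydrodynamicLimit.Theorems.ContactSourceDuhamel.TimeLocal.Reduction
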